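import Summits.NavierStokesRegularity.NavierStokesRegularity.Theorems.SoloRefuteSmith2006Forcing

/-!
# D-0090 NS-CLAIMS, claim C06 `Smith2006` — calculus kit for the comparison countermodel

Cell `ns-claims`; refuter `ns-claims-refuter-4` (g3). Helper file (no route item is asserted): partial
derivatives `pd` on `ℝ³` (chain rules, Schwarz symmetry, sums), slab regularity lemmas for space-time fields
that are smooth and supported in a ball (`C²` on the slab, bounded, `H^{2,2}` on `[0,T] × ℝ³` in the sense of
`Literature.Claims.NS.Smith2006.IsH22OnSlab`), the spatial profiles of the countermodel (the bump `ψ = β`,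
`∂ᵢψ`, `∂ₖ∂ᵢψ`, `Δψ`, `|∇ψ|²`, a wider bump `χ`) with the identities `∂ᵢ|∇ψ|² = 2∑ₖ∂ₖψ∂ₖ∂ᵢψ` and
`∂ᵢΔψ = ∑ₖ∂ₖ(∂ₖ∂ᵢψ)`, sup bounds, the sign change of `∂₀ψ` along the `x₀`-axis (mean value theorem), and
the time profiles `θ = t³`, `a = t³ + 3λt²`, `a′`, `a″`. Consumed by `SoloRefuteSmith2006Comparison.lean`
(`not_ComparisonAuxClassical`). All statements are folklore calculus.

WHAT THIS IS NOT: not a claim about NS regularity or blow-up; not a claim about any author beyond the typed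
locator.
-/

-- The summit's canonical theorem namespace repeats the summit name (single-conjunct summit).
set_option linter.dupNamespace false

noncomputable section

open Set Function MeasureTheory Metric Filter
open scoped ContDiff ENNReal Topology

namespace Summit.NavierStokesRegularity.NavierStokesRegularity.Theorems.Smith2006

open Literature.Claims.NS.Smith2006

/-! ### Generic calculus for the partial-derivative operator `pd` -/

/-- The standard basis vector `eₖ` of `ℝ³`. [folklore] -/
abbrev e (k : Fin 3) : R3 := EuclideanSpace.single k 1

/-- `pd` computed from a Fréchet derivative. [folklore] -/
theorem pd_of_hasFDerivAt {g : R3 → ℝ} {L : R3 →L[ℝ] ℝ} {x : R3} (h : HasFDerivAt g L x) (k : Fin 3) :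
    pd g k x = L (e k) := by
  rw [pd, h.fderiv]

/-- `pd` of a function vanishing near `x` is `0`. [folklore] -/
theorem pd_of_eventuallyEq_zero {g : R3 → ℝ} {x : R3} (h : g =ᶠ[𝓝 x] fun _ => 0) (k : Fin 3) :
    pd g k x = 0 := by
  rw [pd, h.fderiv_eq]; simp

/-- Second partials of a `C²` function are iterated Fréchet derivatives. [folklore] -/
theorem pd_pd_eq {g : R3 → ℝ} (hg : ContDiff ℝ 2 g) (i k : Fin 3) (x : R3) :
    pd (fun y => pd g i y) k x = fderiv ℝ (fderiv ℝ g) x (e k) (e i) := by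
  have h1 : ContDiff ℝ 1 (fderiv ℝ g) := hg.fderiv_right (by norm_num)
  have hd : HasFDerivAt (fderiv ℝ g) (fderiv ℝ (fderiv ℝ g) x) x :=
    (h1.differentiable (by norm_num) x).hasFDerivAt
  have h2 : HasFDerivAt (fun y => fderiv ℝ g y (e i))
      ((fderiv ℝ g x).comp (0 : R3 →L[ℝ] R3) + (fderiv ℝ (fderiv ℝ g) x).flip (e i)) x :=
    hd.clm_apply (hasFDerivAt_const (e i) x)
  show fderiv ℝ (fun y => fderiv ℝ g y (e i)) x (e k) = _
  rw [h2.fderiv]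
  simp

/-- **Schwarz.** Mixed second partials of a `C²` function commute. [folklore] -/
theorem pd_comm {g : R3 → ℝ} (hg : ContDiff ℝ 2 g) (i k : Fin 3) (x : R3) :
    pd (fun y => pd g i y) k x = pd (fun y => pd g k y) i x := by
  rw [pd_pd_eq hg, pd_pd_eq hg]
  exact (hg.contDiffAt.isSymmSndFDerivAt (by simp)) (e k) (e i)

/-- A partial derivative of a `C^∞` function is `C^∞`. [folklore] -/
theorem contDiff_pd {g : R3 → ℝ} (hg : ContDiff ℝ ∞ g) (k : Fin 3) : ContDiff ℝ ∞ fun y => pd g k y :=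
  (contDiff_infty_iff_fderiv.1 hg).2.clm_apply contDiff_const

/-- A partial derivative of a function vanishing outside the ball of radius `R` vanishes there too.
[folklore] -/
theorem pd_eq_zero_of_support {g : R3 → ℝ} {R : ℝ} (hR : ∀ x : R3, R < ‖x‖ → g x = 0) (k : Fin 3)
    (x : R3) (hx : R < ‖x‖) : pd g k x = 0 := by
  apply pd_of_eventuallyEq_zero
  have ho : IsOpen {y : R3 | R < ‖y‖} := isOpen_lt continuous_const continuous_norm
  filter_upwards [ho.mem_nhds hx] with y hy using hR y hy

/-! ### Slab lemmas on `S = [0, T]` for fields smooth on space-time and supported in `‖x‖ ≤ R` -/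

/-- `[0, T]` is a time slab of the print (`t̂ = 0 < T < ∞`). [folklore] -/
theorem isTimeSlab_Icc {T : ℝ} (hT : 0 < T) : IsTimeSlab 0 (Icc 0 T) := Or.inl ⟨T, hT, rfl⟩

/-- Unique differentiability on `[0, T] × ℝ³`. [folklore] -/
theorem uniqueDiffOn_Icc_slab {T : ℝ} (hT : 0 < T) : UniqueDiffOn ℝ (Icc 0 T ×ˢ (univ : Set R3)) :=
  (uniqueDiffOn_Icc hT).prod uniqueDiffOn_univ

/-- A space-time smooth field is `C²` on every slab. [folklore] -/
theorem isCkOnSlab_of_contDiff {W : ℝ → R3 → ℝ} (hs : ContDiff ℝ ∞ (uncurry W)) (S : Set ℝ) :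
    IsCkOnSlab 2 S W :=
  (hs.of_le (WithTop.coe_le_coe.mpr le_top)).contDiffOn

/-- A continuous field vanishing for `‖x‖ > R` is bounded on `[0, T] × ℝ³`. [folklore] -/
theorem exists_boundedBySlab {W : ℝ → R3 → ℝ} {R T : ℝ} (hc : Continuous (uncurry W))
    (hR : ∀ t x, R < ‖x‖ → W t x = 0) : ∃ M, 0 ≤ M ∧ BoundedBySlab M (Icc 0 T) W := by
  obtain ⟨C, hC⟩ := (isCompact_Icc.prod (isCompact_closedBall (0 : R3) R)).exists_bound_of_continuousOn
    (s := Icc 0 T ×ˢ closedBall (0 : R3) R) hc.continuousOn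
  refine ⟨max C 0, le_max_right _ _, fun t ht x => ?_⟩
  by_cases hx : R < ‖x‖
  · rw [hR t x hx, abs_zero]; exact le_max_right _ _
  · have := hC (t, x) ⟨ht, mem_closedBall_zero_iff.2 (not_lt.1 hx)⟩
    exact (le_trans (by simpa [Real.norm_eq_abs] using this) (le_max_left _ _))

/-- **`H^{2,2}` on a finite slab.** A space-time smooth field vanishing for `‖x‖ > R` has all within-slab
derivatives of order `≤ 2` square integrable on `[0, T] × ℝ³`: they are continuous, vanish off the compact
`[0, T] × B̄(0, R)`, hence are bounded with bounded support. [folklore] -/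
theorem isH22OnSlab_of_support {W : ℝ → R3 → ℝ} {R T : ℝ} (hT : 0 < T) (hs : ContDiff ℝ ∞ (uncurry W))
    (hR : ∀ t x, R < ‖x‖ → W t x = 0) : IsH22OnSlab (Icc 0 T) W := by
  intro k _
  set s : Set (ℝ × R3) := Icc 0 T ×ˢ univ with hs_def
  set K : Set (ℝ × R3) := Icc 0 T ×ˢ closedBall (0 : R3) R with hK_def
  set D := iteratedFDerivWithin ℝ k (uncurry W) s with hD_def
  have hKc : IsCompact K := isCompact_Icc.prod (isCompact_closedBall _ _)
  have hcont : ContinuousOn D s :=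
    hs.contDiffOn.continuousOn_iteratedFDerivWithin (by exact_mod_cast (le_top : (k : ℕ∞) ≤ ⊤))
      (uniqueDiffOn_Icc_slab hT)
  have hzero : ∀ q ∈ s, R < ‖q.2‖ → D q = 0 := by
    intro q _ hRq
    have ho : IsOpen {p : ℝ × R3 | R < ‖p.2‖} :=
      isOpen_lt continuous_const (continuous_norm.comp continuous_snd)
    have hev : uncurry W =ᶠ[𝓝[s] q] fun _ => (0 : ℝ) := by
      refine Filter.eventually_of_mem (nhdsWithin_le_nhds (ho.mem_nhds hRq)) fun p hp => ?_
      exact hR p.1 p.2 hp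
    rw [hD_def, hev.iteratedFDerivWithin_eq (hR q.1 q.2 hRq)]
    exact congrFun iteratedFDerivWithin_fun_zero q
  obtain ⟨C, hC⟩ := hKc.exists_bound_of_continuousOn (hcont.mono (prod_mono le_rfl (subset_univ _)))
  have hbd : ∀ q ∈ s, ‖D q‖ₑ ^ 2 ≤ K.indicator (fun _ => ENNReal.ofReal (max C 0) ^ 2) q := by
    intro q hq
    by_cases hq2 : R < ‖q.2‖
    · have h0 : D q = 0 := hzero q hq hq2
      rw [← ofReal_norm, h0, norm_zero, ENNReal.ofReal_zero, zero_pow two_ne_zero]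
      exact zero_le
    · have hqK : q ∈ K := ⟨hq.1, mem_closedBall_zero_iff.2 (not_lt.1 hq2)⟩
      rw [indicator_of_mem hqK]
      gcongr
      rw [← ofReal_norm]
      exact ENNReal.ofReal_le_ofReal ((hC q hqK).trans (le_max_left _ _))
  have hKm : MeasurableSet K := measurableSet_Icc.prod measurableSet_closedBall
  calc ∫⁻ q in s, ‖D q‖ₑ ^ 2 ≤ ∫⁻ q in s, K.indicator (fun _ => ENNReal.ofReal (max C 0) ^ 2) q :=
        setLIntegral_mono' (measurableSet_Icc.prod MeasurableSet.univ) hbd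
    _ = ENNReal.ofReal (max C 0) ^ 2 * volume.restrict s K := lintegral_indicator_const hKm _
    _ ≤ ENNReal.ofReal (max C 0) ^ 2 * volume K := by
        gcongr; exact Measure.restrict_le_self
    _ < ⊤ := ENNReal.mul_lt_top (by simp) hKc.measure_lt_top

/-! ### `pd` arithmetic -/

/-- `pd` of a constant multiple. [folklore] -/
theorem pd_const_mul {g : R3 → ℝ} {x : R3} (hg : DifferentiableAt ℝ g x) (c : ℝ) (k : Fin 3) :
    pd (fun y => c * g y) k x = c * pd g k x := by
  rw [pd_of_hasFDerivAt (hg.hasFDerivAt.const_mul c) k]; simp [pd]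

/-- `pd` of a square. [folklore] -/
theorem pd_sq {g : R3 → ℝ} {x : R3} (hg : DifferentiableAt ℝ g x) (k : Fin 3) :
    pd (fun y => g y ^ 2) k x = 2 * g x * pd g k x := by
  have h : HasFDerivAt (fun y => g y * g y) (g x • fderiv ℝ g x + g x • fderiv ℝ g x) x :=
    hg.hasFDerivAt.mul hg.hasFDerivAt
  have h2 : (fun y => g y ^ 2) = fun y => g y * g y := funext fun y => sq (g y)
  rw [h2, pd_of_hasFDerivAt h k]; simp [pd]; ring

/-- `pd` of a finite sum of differentiable functions. [folklore] -/
theorem pd_sum {g : Fin 3 → R3 → ℝ} {x : R3} (hg : ∀ k, DifferentiableAt ℝ (g k) x) (i : Fin 3) :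
    pd (fun y => ∑ k, g k y) i x = ∑ k, pd (g k) i x := by
  have h : HasFDerivAt (fun y => ∑ k, g k y) (∑ k, fderiv ℝ (g k) x) x := by
    convert HasFDerivAt.fun_sum (u := Finset.univ) (fun k _ => (hg k).hasFDerivAt) using 1
  rw [pd_of_hasFDerivAt h i]; simp [pd]

/-! ### The spatial profiles: the bump `ψ = β`, its partials, `Δψ`, `|∇ψ|²`, and a wider bump `χ` -/

/-- The potential `ψ`: Mathlib's smooth bump `β` (`= 1` on `B̄(0,1)`, support `B(0,2)`). [folklore] -/
abbrev ψ : R3 → ℝ := β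

/-- `∂ᵢψ`. [folklore] -/
def dψ (i : Fin 3) (x : R3) : ℝ := pd ψ i x

/-- `∂ₖ∂ᵢψ`. [folklore] -/
def ddψ (i k : Fin 3) (x : R3) : ℝ := pd (dψ i) k x

/-- `Δψ = ∑ₖ ∂ₖ∂ₖψ`. [folklore] -/
def Lψ (x : R3) : ℝ := ∑ k, ddψ k k x

/-- `|∇ψ|² = ∑ₖ (∂ₖψ)²`. [folklore] -/
def Gψ (x : R3) : ℝ := ∑ k, dψ k x ^ 2

/-- A wider bump `χ` (`= 1` on `B̄(0,2) ⊇ supp ψ`, support `B(0,3)`). [folklore] -/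
def χb : ContDiffBump (0 : R3) := ⟨2, 3, two_pos, by norm_num⟩

/-- `χ` as a function. [folklore] -/
abbrev χ : R3 → ℝ := χb

/-- `ψ` is `Cⁿ` for every `n`. [folklore] -/
theorem contDiffAll_ψ (n : ℕ∞) : ContDiff ℝ n ψ := β.contDiff
/-- `∂ᵢψ` is smooth. [folklore] -/
theorem contDiff_dψ (i : Fin 3) : ContDiff ℝ ∞ (dψ i) := contDiff_pd (contDiffAll_ψ ⊤) i
/-- `∂ₖ∂ᵢψ` is smooth. [folklore] -/
theorem contDiff_ddψ (i k : Fin 3) : ContDiff ℝ ∞ (ddψ i k) := contDiff_pd (contDiff_dψ i) k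
/-- `Δψ` is smooth. [folklore] -/
theorem contDiff_Lψ : ContDiff ℝ ∞ Lψ := ContDiff.sum fun k _ => contDiff_ddψ k k
/-- `|∇ψ|²` is smooth. [folklore] -/
theorem contDiff_Gψ : ContDiff ℝ ∞ Gψ := ContDiff.sum fun k _ => (contDiff_dψ k).pow 2
/-- `χ` is `Cⁿ` for every `n`. [folklore] -/
theorem contDiffAll_χ (n : ℕ∞) : ContDiff ℝ n χ := χb.contDiff

/-- `ψ = 0` for `‖x‖ > 2`. [folklore] -/
theorem ψ_zero_of {x : R3} (hx : 2 < ‖x‖) : ψ x = 0 :=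
  β.zero_of_le_dist (by simpa [β] using hx.le)
/-- `∂ᵢψ = 0` for `‖x‖ > 2`. [folklore] -/
theorem dψ_zero_of (i : Fin 3) {x : R3} (hx : 2 < ‖x‖) : dψ i x = 0 :=
  pd_eq_zero_of_support (fun _ h => ψ_zero_of h) i x hx
/-- `∂ₖ∂ᵢψ = 0` for `‖x‖ > 2`. [folklore] -/
theorem ddψ_zero_of (i k : Fin 3) {x : R3} (hx : 2 < ‖x‖) : ddψ i k x = 0 :=
  pd_eq_zero_of_support (fun _ h => dψ_zero_of i h) k x hx
/-- `Δψ = 0` for `‖x‖ > 2`. [folklore] -/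
theorem Lψ_zero_of {x : R3} (hx : 2 < ‖x‖) : Lψ x = 0 := by simp [Lψ, ddψ_zero_of _ _ hx]
/-- `|∇ψ|² = 0` for `‖x‖ > 2`. [folklore] -/
theorem Gψ_zero_of {x : R3} (hx : 2 < ‖x‖) : Gψ x = 0 := by simp [Gψ, dψ_zero_of _ hx]
/-- `χ = 0` for `‖x‖ > 3`. [folklore] -/
theorem χ_zero_of {x : R3} (hx : 3 < ‖x‖) : χ x = 0 :=
  χb.zero_of_le_dist (by simpa [χb] using hx.le)
/-- `χ = 1` for `‖x‖ ≤ 2`. [folklore] -/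
theorem χ_one_of {x : R3} (hx : ‖x‖ ≤ 2) : χ x = 1 :=
  χb.one_of_mem_closedBall (by simpa [χb] using hx)
/-- `χ ≥ 0`. [folklore] -/
theorem χ_nonneg (x : R3) : 0 ≤ χ x := χb.nonneg
/-- `|ψ| ≤ 1`. [folklore] -/
theorem abs_ψ_le (x : R3) : |ψ x| ≤ 1 := abs_le.2 ⟨by linarith [β.nonneg (x := x)], β.le_one⟩

/-- Schwarz for `ψ`: `∂ₖ∂ᵢψ = ∂ᵢ∂ₖψ`. [folklore] -/
theorem ddψ_comm (i k : Fin 3) (x : R3) : ddψ i k x = ddψ k i x :=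
  pd_comm ((contDiffAll_ψ ⊤).of_le (WithTop.coe_le_coe.mpr le_top)) i k x

/-- (I1) `∂ᵢ|∇ψ|² = 2 ∑ₖ ∂ₖψ ∂ₖ∂ᵢψ`. [folklore] -/
theorem pd_Gψ (i : Fin 3) (x : R3) : pd Gψ i x = 2 * ∑ k, dψ k x * ddψ i k x := by
  have hd : ∀ k, DifferentiableAt ℝ (dψ k) x := fun k => (contDiff_dψ k).differentiable (by simp) x
  have hs : pd (fun y => ∑ k, dψ k y ^ 2) i x = ∑ k, pd (fun y => dψ k y ^ 2) i x :=
    pd_sum (g := fun k y => dψ k y ^ 2) (fun k => (hd k).pow 2) i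
  unfold Gψ
  rw [hs, Finset.mul_sum]
  refine Finset.sum_congr rfl fun k _ => ?_
  rw [pd_sq (hd k), ddψ_comm i k]; simp [ddψ]; ring

/-- (I2) `∂ᵢΔψ = ∑ₖ ∂ₖ(∂ₖ∂ᵢψ)` (third-order symmetry, from Schwarz twice). [folklore] -/
theorem pd_Lψ (i : Fin 3) (x : R3) : pd Lψ i x = ∑ k, pd (ddψ i k) k x := by
  have hd : ∀ k, DifferentiableAt ℝ (ddψ k k) x := fun k => (contDiff_ddψ k k).differentiable (by simp) x
  have hs : pd (fun y => ∑ k, ddψ k k y) i x = ∑ k, pd (ddψ k k) i x :=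
    pd_sum (g := fun k => ddψ k k) hd i
  unfold Lψ
  rw [hs]
  refine Finset.sum_congr rfl fun k _ => ?_
  have h1 : pd (ddψ k k) i x = pd (fun y => pd (dψ k) i y) k x :=
    pd_comm ((contDiff_dψ k).of_le (WithTop.coe_le_coe.mpr le_top)) k i x
  have h2 : (fun y => pd (dψ k) i y) = ddψ i k := by
    funext y; exact ddψ_comm k i y
  rw [h1, h2]

/-- A continuous function vanishing for `‖x‖ > R` is bounded. [folklore] -/
theorem exists_bound_of_support {g : R3 → ℝ} {R : ℝ} (hc : Continuous g) (hR : ∀ x, R < ‖x‖ → g x = 0) :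
    ∃ C, 0 ≤ C ∧ ∀ x, |g x| ≤ C := by
  obtain ⟨C, hC⟩ := (isCompact_closedBall (0 : R3) R).exists_bound_of_continuousOn hc.continuousOn
  refine ⟨max C 0, le_max_right _ _, fun x => ?_⟩
  by_cases hx : R < ‖x‖
  · rw [hR x hx, abs_zero]; exact le_max_right _ _
  · exact le_trans (by simpa [Real.norm_eq_abs] using hC x (mem_closedBall_zero_iff.2 (not_lt.1 hx)))
      (le_max_left _ _)

/-! ### Time profiles (`θ = t³`, `a = λθ' + θ`, `a' `, `a''`) -/

/-- `θ(t) = t³`. [folklore] -/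
def θ (t : ℝ) : ℝ := t ^ 3
/-- `a(t) = t³ + 3λt²` (so that `λθ' + θ = a`). [folklore] -/
def a (lam t : ℝ) : ℝ := t ^ 3 + 3 * lam * t ^ 2
/-- `a'(t) = 3t² + 6λt`. [folklore] -/
def a1 (lam t : ℝ) : ℝ := 3 * t ^ 2 + 6 * lam * t
/-- `a''(t) = 6t + 6λ`. [folklore] -/
def a2 (lam t : ℝ) : ℝ := 6 * t + 6 * lam

/-- `θ′ = 3t²`. [folklore] -/
theorem hasDerivAt_θ (t : ℝ) : HasDerivAt θ (3 * t ^ 2) t :=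
  (hasDerivAt_pow 3 t).congr_deriv (by norm_num)
/-- `a′ = a₁`. [folklore] -/
theorem hasDerivAt_a (lam t : ℝ) : HasDerivAt (a lam) (a1 lam t) t := by
  have h : HasDerivAt (fun s => s ^ 3 + 3 * lam * s ^ 2) (a1 lam t) t :=
    ((hasDerivAt_pow 3 t).add ((hasDerivAt_pow 2 t).const_mul (3 * lam))).congr_deriv
      (by norm_num [a1]; ring)
  exact h
/-- `a₁′ = a₂`. [folklore] -/
theorem hasDerivAt_a1 (lam t : ℝ) : HasDerivAt (a1 lam) (a2 lam t) t := by
  have h : HasDerivAt (fun s => 3 * s ^ 2 + 6 * lam * s) (a2 lam t) t :=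
    (((hasDerivAt_pow 2 t).const_mul 3).add ((hasDerivAt_id t).const_mul (6 * lam))).congr_deriv
      (by norm_num [a2]; ring)
  exact h

/-- A smooth profile has a Fréchet derivative everywhere. [folklore] -/
theorem hasFDerivAt_of_smooth {g : R3 → ℝ} (hg : ContDiff ℝ ∞ g) (x : R3) : HasFDerivAt g (fderiv ℝ g x) x :=
  (hg.differentiable (by simp) x).hasFDerivAt

/-- `−UC ≤ uy` for `0 ≤ u ≤ U`, `|y| ≤ C`. [folklore] -/
theorem neg_mul_le_of_abs_le {u U y C : ℝ} (hu : 0 ≤ u) (huU : u ≤ U) (hy : |y| ≤ C) :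
    -(U * C) ≤ u * y := by
  have hC : 0 ≤ C := (abs_nonneg y).trans hy
  have h1 := (abs_le.1 hy).1
  nlinarith [mul_nonneg hu (by linarith : 0 ≤ y + C), mul_nonneg (sub_nonneg.2 huU) hC]

/-- `uy ≤ UC` for `0 ≤ u ≤ U`, `|y| ≤ C`. [folklore] -/
theorem mul_le_of_abs_le {u U y C : ℝ} (hu : 0 ≤ u) (huU : u ≤ U) (hy : |y| ≤ C) : u * y ≤ U * C := by
  have hC : 0 ≤ C := (abs_nonneg y).trans hy
  have h1 := (abs_le.1 hy).2
  nlinarith [mul_nonneg hu (by linarith : 0 ≤ C - y), mul_nonneg (sub_nonneg.2 huU) hC]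

/-! ### Sup bounds of the profiles -/

/-- A bound `C_Δ ≥ |Δψ|`. [folklore] -/
theorem exists_CL : ∃ C, 0 ≤ C ∧ ∀ x, |Lψ x| ≤ C :=
  exists_bound_of_support contDiff_Lψ.continuous fun _ hx => Lψ_zero_of hx

/-- A bound `C_G ≥ |∇ψ|²`. [folklore] -/
theorem exists_CG : ∃ C, 0 ≤ C ∧ ∀ x, |Gψ x| ≤ C :=
  exists_bound_of_support contDiff_Gψ.continuous fun _ hx => Gψ_zero_of hx

/-- `C_Δ`. [folklore] -/
def CL : ℝ := Classical.choose exists_CL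

/-- `C_G`. [folklore] -/
def CG : ℝ := Classical.choose exists_CG

/-- `0 ≤ C_Δ` and `|Δψ| ≤ C_Δ`. [folklore] -/
theorem CL_spec : 0 ≤ CL ∧ ∀ x, |Lψ x| ≤ CL := Classical.choose_spec exists_CL

/-- `0 ≤ C_G` and `|∇ψ|² ≤ C_G`. [folklore] -/
theorem CG_spec : 0 ≤ CG ∧ ∀ x, |Gψ x| ≤ CG := Classical.choose_spec exists_CG

/-- The constant in the `p`- and diagonal `Υ`-slots: `c₀ = 14 C_Δ + 7 + 6 C_G`. [folklore] -/
def c₀ : ℝ := 14 * CL + 7 + 6 * CG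

/-- `0 ≤ c₀`. [folklore] -/
theorem c₀_nonneg : 0 ≤ c₀ := by
  have := CL_spec.1; have := CG_spec.1; unfold c₀; positivity

/-! ### The sign change of `v₀ = a ∂₀ψ` (mean value theorem along the `x₀`-axis) -/

/-- `r ↦ ψ(r e₀)` has derivative `∂₀ψ(r e₀)`. [folklore] -/
theorem hasDerivAt_ψ_line (s : ℝ) : HasDerivAt (fun r : ℝ => ψ (r • e 0)) (dψ 0 (s • e 0)) s := by
  have hψ : HasFDerivAt ψ (fderiv ℝ ψ (s • e 0)) (s • e 0) := hasFDerivAt_of_smooth (contDiffAll_ψ ⊤) _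
  have hl : HasDerivAt (fun r : ℝ => r • e 0) (e 0) s := by
    simpa using (hasDerivAt_id s).smul_const (e 0)
  have h := hψ.comp_hasDerivAt s hl
  exact h

/-- `‖r e₀‖ = |r|`. [folklore] -/
theorem norm_smul_e0 (r : ℝ) : ‖r • e 0‖ = |r| := by
  rw [norm_smul]; simp

/-- `∂₀ψ < 0` somewhere (ψ drops from `1` at `0` to `0` at `3e₀`). [folklore] -/
theorem exists_dψ_neg : ∃ x : R3, dψ 0 x < 0 := by
  obtain ⟨r, -, hr⟩ := exists_hasDerivAt_eq_slope (fun r : ℝ => ψ (r • e 0)) (fun r => dψ 0 (r • e 0))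
    (by norm_num : (0 : ℝ) < 3) (fun r _ => (hasDerivAt_ψ_line r).continuousAt.continuousWithinAt)
    (fun r _ => hasDerivAt_ψ_line r)
  refine ⟨r • e 0, ?_⟩
  have key : dψ 0 (r • e 0) = (ψ ((3 : ℝ) • e 0) - ψ ((0 : ℝ) • e 0)) / (3 - 0) := hr
  have h0 : ψ ((0 : ℝ) • e 0) = 1 := by rw [zero_smul]; exact β_zero
  have h3 : ψ ((3 : ℝ) • e 0) = 0 := ψ_zero_of (by rw [norm_smul_e0]; norm_num)
  rw [key, h0, h3]; norm_num

/-- `∂₀ψ > 0` somewhere (ψ rises from `0` at `−3e₀` to `1` at `0`). [folklore] -/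
theorem exists_dψ_pos : ∃ x : R3, 0 < dψ 0 x := by
  obtain ⟨r, -, hr⟩ := exists_hasDerivAt_eq_slope (fun r : ℝ => ψ (r • e 0)) (fun r => dψ 0 (r • e 0))
    (by norm_num : (-3 : ℝ) < 0) (fun r _ => (hasDerivAt_ψ_line r).continuousAt.continuousWithinAt)
    (fun r _ => hasDerivAt_ψ_line r)
  refine ⟨r • e 0, ?_⟩
  have key : dψ 0 (r • e 0) = (ψ ((0 : ℝ) • e 0) - ψ ((-3 : ℝ) • e 0)) / (0 - -3) := hr
  have h0 : ψ ((0 : ℝ) • e 0) = 1 := by rw [zero_smul]; exact β_zero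
  have h3 : ψ ((-3 : ℝ) • e 0) = 0 := ψ_zero_of (by rw [norm_smul_e0]; norm_num)
  rw [key, h0, h3]; norm_num

end Summit.NavierStokesRegularity.NavierStokesRegularity.Theorems.Smith2006

end
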